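import Mathlib
import HarnessLib
import Summits.ValiantsHypothesis.ValiantsHypothesis.Theorems.KPlusLogSqLawWeakLiftingTowerGraftWronskianKFourAlternantConverse

/-!
# Tower graft line — THE ALTERNANT LAW, NAMED (not asserted), and its equivalence with Conjecture W at `K = 4`

Definitions file for LINE (B) `Cruxes/WeakLifting/Lines/tower_graft.lean` (crux `WeakLifting` = stmt-ValiantsHypothesis-19561).  Hand g12 of
leafhand-val-kpluslogsqlaw-1 reduced the located target (W-4) = `ConjectureWAt 4` (`…WronskianConjectureWDefs`, g11) to an explicit inequality
between products of generalized Vandermonde determinants on five-point configurations (`…WronskianKFourAlternant`, `…KFourAlternantConverse`).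
This file only NAMES that statement so that certificates, partial results or a refutation can cite it BY NAME; nothing is asserted.

* `AlternantLawFour` — for all `0 < r₀ < ⋯ < r₄` and all supports `d₀ < d₁ < d₂ < d₃` (naturals) with `d₀ + d₃ < d₁ + d₂`:
  `A₁A₄·w₁w₃ ≠ A₀A₅·w₂w₃ + A₂A₃·w₁w₂`, where `A_t = det [r_m^{e_s}]_{s ≠ t}` are the six maximal minors of the generalized Vandermonde matrix on
  the sorted pair sums `e = (d₀+d₁, d₀+d₂, d₀+d₃, d₁+d₂, d₁+d₃, d₂+d₃)` and `w₁ = (d₁−d₀)(d₃−d₂)`, `w₂ = (d₂−d₀)(d₃−d₁)`, `w₃ = (d₃−d₀)(d₂−d₁)`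
  (numerically the sign is always `<`; all `A_t > 0`);
* ★★ `alternantLawFour_iff_conjectureWAt_four` — `AlternantLawFour ↔ ConjectureWAt 4` (PROVED: `→` is `conjectureWAt_four_of_alternantLaw`,
  `←` is the converse `five_le_of_alternant_identity` through `alternantLaw_iff_orientA`).

Evidence (memo of this hand on stmt-19561): max LHS/RHS = 0.995 over 3.9·10³ random samples; for integer supports the law is the positivity on
`(0,∞)⁵` of the symmetric polynomial `P_d = w₂w₃·s_{λ(0)}s_{λ(5)} + w₁w₂·s_{λ(2)}s_{λ(3)} − w₁w₃·s_{λ(1)}s_{λ(4)}`, found MONOMIAL-POSITIVE (exact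
SSYT expansion) for every primitive support with `d₃ ≤ 10` — conjecturally always; Schur-positivity fails.  OPEN.

HONEST FRAMING: a name for a reformulation; nothing on S4/S4f/S5/S5ᴸ, TowerB, `WeakLifting`, Conjecture B, `MatrixDescartes` (18050), `VP ≠ VNP`.
Seat: prover leafhand-val-kpluslogsqlaw-1 g12, `--supports stmt-ValiantsHypothesis-19561`.  [this work]
-/

-- `Summit.ValiantsHypothesis.ValiantsHypothesis.…` repeats a component by the D-0017 layout
-- (single-conjunct summit), which the `dupNamespace` linter flags; the name is mandated.
set_option linter.dupNamespace false
set_option autoImplicit false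

namespace Summit.ValiantsHypothesis.ValiantsHypothesis.Theorems.KPlusLogSqLaw.TowerGraft

open Polynomial Finset
open scoped BigOperators Polynomial
open Literature.LinearAlgebra.Matrix.GeneralizedVandermonde (genVandermonde)

namespace WronskianDevelopable

/-- **THE ALTERNANT LAW at `K = 4`** (NAMED, not asserted): the alternant identity forced by five positive zeros of `W(u,v)` never holds.
[this work; equivalent to Conjecture W at `K = 4`, cite: SedykhShapiro2005 §1 for the conjecture] -/
def AlternantLawFour : Prop :=
  ∀ (r : Fin 5 → ℝ), StrictMono r → (∀ m, 0 < r m) → ∀ (d : Fin 4 → ℕ), StrictMono d → d 0 + d 3 < d 1 + d 2 →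
    (genVandermonde r ![d 0 + d 1, d 0 + d 3, d 1 + d 2, d 1 + d 3, d 2 + d 3]).det *
        (genVandermonde r ![d 0 + d 1, d 0 + d 2, d 0 + d 3, d 1 + d 2, d 2 + d 3]).det *
        ((((d 1 : ℝ) - d 0) * ((d 3 : ℝ) - d 2)) * (((d 3 : ℝ) - d 0) * ((d 2 : ℝ) - d 1))) ≠
      (genVandermonde r ![d 0 + d 2, d 0 + d 3, d 1 + d 2, d 1 + d 3, d 2 + d 3]).det *
          (genVandermonde r ![d 0 + d 1, d 0 + d 2, d 0 + d 3, d 1 + d 2, d 1 + d 3]).det *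
          ((((d 2 : ℝ) - d 0) * ((d 3 : ℝ) - d 1)) * (((d 3 : ℝ) - d 0) * ((d 2 : ℝ) - d 1))) +
        (genVandermonde r ![d 0 + d 1, d 0 + d 2, d 1 + d 2, d 1 + d 3, d 2 + d 3]).det *
          (genVandermonde r ![d 0 + d 1, d 0 + d 2, d 0 + d 3, d 1 + d 3, d 2 + d 3]).det *
          ((((d 1 : ℝ) - d 0) * ((d 3 : ℝ) - d 2)) * (((d 2 : ℝ) - d 0) * ((d 3 : ℝ) - d 1)))

/-- ★★ **THE ALTERNANT LAW IS EQUIVALENT TO CONJECTURE W AT `K = 4`.** [this work] -/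
theorem alternantLawFour_iff_conjectureWAt_four : AlternantLawFour ↔ ConjectureWAt 4 := by
  constructor
  · intro AL
    exact conjectureWAt_four_of_alternantLaw AL
  · intro CW
    refine alternantLaw_iff_orientA.mpr ?_
    intro u v d hd _
    exact CW u v d hd

end WronskianDevelopable

end Summit.ValiantsHypothesis.ValiantsHypothesis.Theorems.KPlusLogSqLaw.TowerGraft
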